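import Mathlib.NumberTheory.NumberField.DedekindZeta
import Mathlib.NumberTheory.RamificationInertia.Basic
import Mathlib.RingTheory.Ideal.Int
import Literature.NumberTheory.LFunctions.LogEulerProduct
import Literature.NumberTheory.LFunctions.DedekindZeta
import HarnessLib

/-!
# Counting integral ideals by norm, and `log ζ_K(s)` at `s = 1⁺`

Topic `Literature/NumberTheory/LFunctions`. Everything in this file is PROVED (no `sorry`).

For a number field `K` let `c_K(n) = #{I ⊆ 𝓞 K : N(I) = n}` (`Literature.NumberTheory.LFunctions.idealNormCount`, the
coefficients of Mathlib's `NumberField.dedekindZeta`). We prove the classical facts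

* `idealNormCount_one`, `idealNormCount_mul_of_coprime`: `c_K` is multiplicative on coprime
  arguments (`I ↦ (I + (m), I + (n))`, inverse `(A, B) ↦ AB`);
* `idealNormCount_prime_pow_le`: `c_K(p^e) ≤ (e+1)^{[K:ℚ]}` (an ideal of norm `p^e` is
  determined by the exponents `≤ e` of the `≤ [K:ℚ]` primes above `p` in its factorisation);
* `idealNormCount_prime_le`: the crude bound `c_K(p) ≤ 2^{[K:ℚ]}` (case `e = 1`);
* `LSeries_natCast_ofReal`, `summable_term_idealNormCount`,
  `tendsto_sub_one_mul_tsum_idealNormCount`: the real form `Σ c_K(n) n^{-s}` of the Dedekind zeta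
  function for real `s > 1` and of Mathlib's class-number-formula residue
  `NumberField.tendsto_sub_one_mul_dedekindZeta_nhdsGT`;

and deduce from `LogEulerProduct.lean`:

* `exists_tendsto_tsum_primes_idealNormCount_add_log`:
  `Σ_p c_K(p) p^{-s} + log (s-1) → L_K` as `s → 1⁺`;
* `exists_tendsto_tsum_primes_rpow_add_log`: `Σ_p p^{-s} + log (s-1) → L_ℚ` (the case `K = ℚ`,
  where `c_ℚ ≡ 1` by the tree's `card_ideal_rat_absNorm_eq`, `DedekindZeta.lean`);
* `exists_tendsto_tsum_primes_idealNormCount_sub_one`: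
  `Σ_p (c_K(p) - 1) p^{-s}` converges to a finite limit as `s → 1⁺`.

Here `c_K(p) = #{prime ideals of 𝓞 K of norm p}` is the number of degree-one primes above `p`.

## References

* W. Narkiewicz, *Elementary and Analytic Theory of Algebraic Numbers*, 3rd ed., 2004, Ch. 7 §1;
  D. A. Marcus, *Number Fields*, 1977, Ch. 7. [folklore]
-/

noncomputable section

open Filter Topology Nat Ideal NumberField

namespace Literature.NumberTheory.LFunctions

variable (K : Type*) [Field K] [NumberField K]

/-- `c_K(n)`: the number of integral ideals of `𝓞 K` of absolute norm `n` (the `n`-th coefficient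
of the Dedekind zeta function, cf. `NumberField.dedekindZeta`). Junk value `c_K(0) = 1` (the zero
ideal). [folklore] -/
def idealNormCount (n : ℕ) : ℕ := Nat.card {I : Ideal (𝓞 K) // absNorm I = n}

/-- Auxiliary (proof-internal). [folklore] -/
lemma idealNormCount_def (n : ℕ) :
    idealNormCount K n = Nat.card {I : Ideal (𝓞 K) // absNorm I = n} := rfl

/-- The Dedekind zeta function is the `L`-series of `c_K`. [folklore] -/
lemma dedekindZeta_eq_LSeries (s : ℂ) :
    dedekindZeta K s = LSeries (fun n ↦ (idealNormCount K n : ℂ)) s := rfl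

/-- Auxiliary (proof-internal). [folklore] -/
instance (n : ℕ) : Finite {I : Ideal (𝓞 K) // absNorm I = n} :=
  (Ideal.finite_setOf_absNorm_eq n).to_subtype

/-- `c_K(1) = 1`. [folklore] -/
lemma idealNormCount_one : idealNormCount K 1 = 1 := by
  rw [idealNormCount, Nat.card_eq_one_iff_exists]
  refine ⟨⟨⊤, absNorm_top⟩, fun I => Subtype.ext (absNorm_eq_one_iff.mp I.prop)⟩

/-- `c_K(0) = 1` (only the zero ideal has norm `0`). [folklore] -/
lemma idealNormCount_zero : idealNormCount K 0 = 1 := by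
  rw [idealNormCount, Nat.card_eq_one_iff_exists]
  refine ⟨⟨⊥, absNorm_bot⟩, fun I => Subtype.ext (absNorm_eq_zero_iff.mp I.prop)⟩

/-! ### Multiplicativity on coprime arguments -/

namespace IdealNormCount

variable {K}
variable {R : Type*} [CommRing R]

/-- In a commutative ring, coprime integers generate coprime principal ideals. [folklore] -/
lemma span_natCast_sup_span_natCast_eq_top {m n : ℕ} (h : m.Coprime n) :
    Ideal.span {(m : R)} ⊔ Ideal.span {(n : R)} = ⊤ := by
  have hz : IsCoprime (m : ℤ) (n : ℤ) := Nat.isCoprime_iff_coprime.mpr h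
  have hR : IsCoprime ((m : ℤ) : R) ((n : ℤ) : R) := hz.map (Int.castRingHom R)
  simp only [Int.cast_natCast] at hR
  rwa [← Ideal.isCoprime_span_singleton_iff, Ideal.isCoprime_iff_sup_eq] at hR

/-- `(I ⊔ (a)) * (I ⊔ (b)) ≤ I` when `a * b ∈ I`. [folklore] -/
lemma sup_span_mul_sup_span_le {I : Ideal R} {a b : R} (hab : a * b ∈ I) :
    (I ⊔ Ideal.span {a}) * (I ⊔ Ideal.span {b}) ≤ I := by
  rw [Ideal.mul_le]
  intro r hr s hs
  rw [sup_comm, Ideal.mem_span_singleton_sup] at hr hs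
  obtain ⟨x, i, hi, rfl⟩ := hr
  obtain ⟨y, j, hj, rfl⟩ := hs
  have : (x * a + i) * (y * b + j) = x * y * (a * b) + (x * a) * j + i * (y * b + j) := by ring
  rw [this]
  exact I.add_mem (I.add_mem (I.mul_mem_left _ hab) (I.mul_mem_left _ hj)) (I.mul_mem_right _ hi)

/-- If `a * b ∈ I` and `(a) + (b) = R` then `I = (I + (a)) (I + (b))`. [folklore] -/
lemma sup_span_mul_sup_span_eq {I : Ideal R} {a b : R} (hab : a * b ∈ I)
    (hco : Ideal.span {a} ⊔ Ideal.span {b} = ⊤) :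
    (I ⊔ Ideal.span {a}) * (I ⊔ Ideal.span {b}) = I := by
  refine le_antisymm (sup_span_mul_sup_span_le hab) ?_
  rw [Ideal.mul_eq_inf_of_coprime]
  · exact le_inf le_sup_left le_sup_left
  · rw [eq_top_iff, ← hco]
    exact sup_le_sup le_sup_right le_sup_right

/-- If `a ∈ A`, `b ∈ B` and `(a) + (b) = R` then `A B + (a) = A`. [folklore] -/
lemma mul_sup_span_eq {A B : Ideal R} {a b : R} (ha : a ∈ A) (hb : b ∈ B)
    (hco : Ideal.span {a} ⊔ Ideal.span {b} = ⊤) : A * B ⊔ Ideal.span {a} = A := by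
  refine le_antisymm (sup_le Ideal.mul_le_right ((Ideal.span_singleton_le_iff_mem _).mpr ha)) ?_
  have hB : B ⊔ Ideal.span {a} = ⊤ := by
    rw [eq_top_iff, ← hco, sup_comm]
    exact sup_le_sup ((Ideal.span_singleton_le_iff_mem _).mpr hb) le_rfl
  calc A = A * (B ⊔ Ideal.span {a}) := by rw [hB, Ideal.mul_top]
    _ = A * B ⊔ A * Ideal.span {a} := Ideal.mul_sup _ _ _
    _ ≤ A * B ⊔ Ideal.span {a} := sup_le_sup le_rfl Ideal.mul_le_left

variable (K)

/-- The norm of `(m) ⊆ 𝓞 K` is `m^{[K:ℚ]}`. [folklore] -/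
lemma absNorm_span_natCast (m : ℕ) :
    absNorm (Ideal.span {(m : 𝓞 K)}) = m ^ Module.finrank ℚ K := by
  rw [Ideal.absNorm_span_singleton, show (m : 𝓞 K) = algebraMap ℤ (𝓞 K) m by simp,
    Algebra.norm_algebraMap, ← RingOfIntegers.rank K]
  simp [Int.natAbs_pow]

/-- For an ideal `A ⊇ (m)`, `N(A)` is coprime to every `n` coprime to `m`. [folklore] -/
lemma coprime_absNorm_of_span_le {A : Ideal (𝓞 K)} {m n : ℕ}
    (hA : Ideal.span {(m : 𝓞 K)} ≤ A) (h : m.Coprime n) : (absNorm A).Coprime n := by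
  have hdvd : absNorm A ∣ m ^ Module.finrank ℚ K := by
    rw [← absNorm_span_natCast K m]
    exact Ideal.absNorm_dvd_absNorm_of_le hA
  exact Nat.Coprime.coprime_dvd_left hdvd (Nat.Coprime.pow_left _ h)

/-- The bijection `{I : N(I) = mn} ≃ {A : N(A) = m} × {B : N(B) = n}` for coprime `m, n ≥ 1`:
`I ↦ (I + (m), I + (n))`, `(A, B) ↦ AB`. [folklore] -/
def equivProdOfCoprime {m n : ℕ} (hm : 0 < m) (hn : 0 < n) (h : m.Coprime n) :
    {I : Ideal (𝓞 K) // absNorm I = m * n} ≃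
      {A : Ideal (𝓞 K) // absNorm A = m} × {B : Ideal (𝓞 K) // absNorm B = n} where
  toFun I := by
    have hco : Ideal.span {(m : 𝓞 K)} ⊔ Ideal.span {(n : 𝓞 K)} = ⊤ :=
      span_natCast_sup_span_natCast_eq_top h
    have hmn : (m : 𝓞 K) * n ∈ I.1 := by
      have := Ideal.absNorm_mem I.1
      rw [I.2] at this
      exact_mod_cast this
    have hprod : (I.1 ⊔ Ideal.span {(m : 𝓞 K)}) * (I.1 ⊔ Ideal.span {(n : 𝓞 K)}) = I.1 :=
      sup_span_mul_sup_span_eq hmn hco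
    have hN : absNorm (I.1 ⊔ Ideal.span {(m : 𝓞 K)}) * absNorm (I.1 ⊔ Ideal.span {(n : 𝓞 K)})
        = m * n := by rw [← map_mul, hprod, I.2]
    have hA : (absNorm (I.1 ⊔ Ideal.span {(m : 𝓞 K)})).Coprime n :=
      coprime_absNorm_of_span_le K le_sup_right h
    have hB : (absNorm (I.1 ⊔ Ideal.span {(n : 𝓞 K)})).Coprime m :=
      coprime_absNorm_of_span_le K le_sup_right h.symm
    have hAdvd : absNorm (I.1 ⊔ Ideal.span {(m : 𝓞 K)}) ∣ m :=
      hA.dvd_of_dvd_mul_right (Dvd.intro _ hN)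
    have hBdvd : absNorm (I.1 ⊔ Ideal.span {(n : 𝓞 K)}) ∣ n :=
      hB.dvd_of_dvd_mul_left (Dvd.intro_left _ hN)
    have hAle := Nat.le_of_dvd hm hAdvd
    have hBle := Nat.le_of_dvd hn hBdvd
    refine (⟨⟨I.1 ⊔ Ideal.span {(m : 𝓞 K)}, ?_⟩, ⟨I.1 ⊔ Ideal.span {(n : 𝓞 K)}, ?_⟩⟩)
    · by_contra hne
      have hlt := lt_of_le_of_ne hAle hne
      have : absNorm (I.1 ⊔ Ideal.span {(m : 𝓞 K)}) * absNorm (I.1 ⊔ Ideal.span {(n : 𝓞 K)})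
          < m * n := by
        calc _ ≤ absNorm (I.1 ⊔ Ideal.span {(m : 𝓞 K)}) * n := Nat.mul_le_mul_left _ hBle
          _ < m * n := Nat.mul_lt_mul_of_pos_right hlt hn
      omega
    · by_contra hne
      have hlt := lt_of_le_of_ne hBle hne
      have : absNorm (I.1 ⊔ Ideal.span {(m : 𝓞 K)}) * absNorm (I.1 ⊔ Ideal.span {(n : 𝓞 K)})
          < m * n := by
        calc _ ≤ m * absNorm (I.1 ⊔ Ideal.span {(n : 𝓞 K)}) := Nat.mul_le_mul_right _ hAle
          _ < m * n := Nat.mul_lt_mul_of_pos_left hlt hm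
      omega
  invFun AB := ⟨AB.1.1 * AB.2.1, by rw [map_mul, AB.1.2, AB.2.2]⟩
  left_inv I := by
    apply Subtype.ext
    simp only
    have hco : Ideal.span {(m : 𝓞 K)} ⊔ Ideal.span {(n : 𝓞 K)} = ⊤ :=
      span_natCast_sup_span_natCast_eq_top h
    have hmn : (m : 𝓞 K) * n ∈ I.1 := by
      have := Ideal.absNorm_mem I.1
      rw [I.2] at this
      exact_mod_cast this
    exact sup_span_mul_sup_span_eq hmn hco
  right_inv AB := by
    obtain ⟨⟨A, hA⟩, ⟨B, hB⟩⟩ := AB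
    have hco : Ideal.span {(m : 𝓞 K)} ⊔ Ideal.span {(n : 𝓞 K)} = ⊤ :=
      span_natCast_sup_span_natCast_eq_top h
    have ha : (m : 𝓞 K) ∈ A := by have := Ideal.absNorm_mem A; rwa [hA] at this
    have hb : (n : 𝓞 K) ∈ B := by have := Ideal.absNorm_mem B; rwa [hB] at this
    simp only [Prod.mk.injEq, Subtype.mk.injEq]
    refine ⟨mul_sup_span_eq ha hb hco, ?_⟩
    rw [mul_comm]
    exact mul_sup_span_eq hb ha (by rwa [sup_comm])

end IdealNormCount

/-- `c_K` is multiplicative on coprime arguments. [folklore] -/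
lemma idealNormCount_mul_of_coprime {m n : ℕ} (h : m.Coprime n) :
    idealNormCount K (m * n) = idealNormCount K m * idealNormCount K n := by
  rcases Nat.eq_zero_or_pos m with rfl | hm
  · have hn : n = 1 := by simpa using h
    subst hn
    simp [idealNormCount_one]
  rcases Nat.eq_zero_or_pos n with rfl | hn
  · have hm1 : m = 1 := by simpa using h
    subst hm1
    simp [idealNormCount_one]
  rw [idealNormCount, idealNormCount, idealNormCount,
    Nat.card_congr (IdealNormCount.equivProdOfCoprime K hm hn h), Nat.card_prod]

/-! ### Ideals of prime-power norm -/

namespace IdealNormCount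

open UniqueFactorizationMonoid

variable {K}

/-- A prime factor of an ideal of norm `p^e` lies over `p`. [folklore] -/
lemma mem_primesOver_of_mem_normalizedFactors {p : ℕ} (hp : p.Prime) {e : ℕ}
    {I : Ideal (𝓞 K)} (hI : absNorm I = p ^ e) {P : Ideal (𝓞 K)}
    (hP : P ∈ normalizedFactors I) :
    P ∈ (Ideal.span {(p : ℤ)}).primesOver (𝓞 K) := by
  have hI0 : I ≠ ⊥ := by
    intro h; rw [h, absNorm_bot] at hI; exact pow_ne_zero e hp.ne_zero hI.symm
  rw [Ideal.mem_normalizedFactors_iff hI0] at hP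
  obtain ⟨hPprime, hIP⟩ := hP
  haveI := Fact.mk hp
  haveI : (Ideal.span {(p : ℤ)}).IsMaximal := Int.ideal_span_isMaximal_of_prime p
  have hp0 : Ideal.span {(p : ℤ)} ≠ ⊥ := by simp [hp.ne_zero]
  rw [Ideal.mem_primesOver_iff_mem_normalizedFactors _ hp0,
    Ideal.mem_normalizedFactors_iff (Ideal.map_ne_bot_of_ne_bot hp0)]
  refine ⟨hPprime, ?_⟩
  rw [Ideal.map_span, Set.image_singleton, Ideal.span_singleton_le_iff_mem]
  have hdvd : absNorm P ∣ p ^ e := hI ▸ Ideal.absNorm_dvd_absNorm_of_le hIP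
  obtain ⟨j, -, hPj⟩ := (Nat.dvd_prime_pow hp).mp hdvd
  have hmem : ((absNorm P : ℕ) : 𝓞 K) ∈ P := Ideal.absNorm_mem P
  rw [hPj, Nat.cast_pow] at hmem
  simpa using hPprime.mem_of_pow_mem j hmem

/-- The absolute norm of a prime factor of an ideal of norm `p^e` is at least `p`. [folklore] -/
lemma le_absNorm_of_mem_normalizedFactors {p : ℕ} (hp : p.Prime) {e : ℕ}
    {I : Ideal (𝓞 K)} (hI : absNorm I = p ^ e) {P : Ideal (𝓞 K)}
    (hP : P ∈ normalizedFactors I) : p ≤ absNorm P := by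
  have hI0 : I ≠ ⊥ := by
    intro h; rw [h, absNorm_bot] at hI; exact pow_ne_zero e hp.ne_zero hI.symm
  have hP' := (Ideal.mem_normalizedFactors_iff hI0).mp hP
  have hdvd : absNorm P ∣ p ^ e := hI ▸ Ideal.absNorm_dvd_absNorm_of_le hP'.2
  obtain ⟨j, -, hPj⟩ := (Nat.dvd_prime_pow hp).mp hdvd
  rw [hPj]
  rcases Nat.eq_zero_or_pos j with rfl | hj
  · exfalso
    rw [pow_zero, absNorm_eq_one_iff] at hPj
    exact hP'.1.ne_top hPj
  · calc p = p ^ 1 := (pow_one p).symm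
      _ ≤ p ^ j := Nat.pow_le_pow_right hp.pos hj

/-- An ideal of norm `p^e` has at most `e` prime factors (with multiplicity). [folklore] -/
lemma card_normalizedFactors_le {p : ℕ} (hp : p.Prime) {e : ℕ}
    {I : Ideal (𝓞 K)} (hI : absNorm I = p ^ e) :
    Multiset.card (normalizedFactors I) ≤ e := by
  have hI0 : I ≠ ⊥ := by
    intro h; rw [h, absNorm_bot] at hI; exact pow_ne_zero e hp.ne_zero hI.symm
  have hprod : (normalizedFactors I).prod = I :=
    associated_iff_eq.mp (prod_normalizedFactors hI0)
  have hN : ((normalizedFactors I).map absNorm).prod = p ^ e := by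
    rw [← map_multiset_prod, hprod, hI]
  have hge : ∀ x ∈ (normalizedFactors I).map absNorm, p ≤ x := by
    intro x hx
    obtain ⟨P, hP, rfl⟩ := Multiset.mem_map.mp hx
    exact le_absNorm_of_mem_normalizedFactors hp hI hP
  have := Multiset.pow_card_le_prod hge
  rw [hN, Multiset.card_map] at this
  exact (Nat.pow_le_pow_iff_right hp.one_lt).mp this

variable (K)

/-- There are at most `[K:ℚ]` primes of `𝓞 K` above `p`. [folklore] -/
lemma card_primesOver_le {p : ℕ} (hp : p.Prime) :
    Nat.card ((Ideal.span {(p : ℤ)}).primesOver (𝓞 K)) ≤ Module.finrank ℚ K := by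
  haveI := Fact.mk hp
  haveI : (Ideal.span {(p : ℤ)}).IsMaximal := Int.ideal_span_isMaximal_of_prime p
  have hp0 : Ideal.span {(p : ℤ)} ≠ ⊥ := by simp [hp.ne_zero]
  rw [Nat.card_coe_set_eq, ← IsDedekindDomain.coe_primesOverFinset hp0 (𝓞 K),
    Set.ncard_coe_finset]
  exact Ideal.card_primesOverFinset_le_finrank (𝓞 K) ℚ K hp0

/-- `c_K(p^e) ≤ (e+1)^{[K:ℚ]}`: an ideal of norm `p^e` is determined by the exponents (`≤ e`)
of the (`≤ [K:ℚ]`) primes above `p` in its factorisation. [folklore] -/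
theorem idealNormCount_prime_pow_le_nat {p : ℕ} (hp : p.Prime) (e : ℕ) :
    idealNormCount K (p ^ e) ≤ (e + 1) ^ Module.finrank ℚ K := by
  classical
  set T := (Ideal.span {(p : ℤ)}).primesOver (𝓞 K) with hT
  haveI := Fact.mk hp
  haveI : Finite T :=
    (IsDedekindDomain.primesOver_finite (Ideal.span {(p : ℤ)}) (𝓞 K)).to_subtype
  let F : {I : Ideal (𝓞 K) // absNorm I = p ^ e} → (T → Fin (e + 1)) := fun I P =>
    ⟨(normalizedFactors I.1).count P.1, Nat.lt_succ_of_le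
      ((Multiset.count_le_card _ _).trans (card_normalizedFactors_le hp I.2))⟩
  have hF : Function.Injective F := by
    intro I J hIJ
    apply Subtype.ext
    have hI0 : I.1 ≠ ⊥ := by
      intro h; have := I.2; rw [h, absNorm_bot] at this
      exact pow_ne_zero e hp.ne_zero this.symm
    have hJ0 : J.1 ≠ ⊥ := by
      intro h; have := J.2; rw [h, absNorm_bot] at this
      exact pow_ne_zero e hp.ne_zero this.symm
    rw [← associated_iff_eq.mp (prod_normalizedFactors hI0),
      ← associated_iff_eq.mp (prod_normalizedFactors hJ0)]
    congr 1
    ext P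
    by_cases hPT : P ∈ T
    · have := congr_fun hIJ ⟨P, hPT⟩
      simpa [F] using congrArg Fin.val this
    · rw [Multiset.count_eq_zero_of_notMem
          (fun h => hPT (mem_primesOver_of_mem_normalizedFactors hp I.2 h)),
        Multiset.count_eq_zero_of_notMem
          (fun h => hPT (mem_primesOver_of_mem_normalizedFactors hp J.2 h))]
  calc idealNormCount K (p ^ e) = Nat.card {I : Ideal (𝓞 K) // absNorm I = p ^ e} := rfl
    _ ≤ Nat.card (T → Fin (e + 1)) := Nat.card_le_card_of_injective F hF
    _ = (e + 1) ^ Nat.card T := by rw [Nat.card_fun]; simp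
    _ ≤ (e + 1) ^ Module.finrank ℚ K := Nat.pow_le_pow_right (Nat.succ_pos e)
        (card_primesOver_le K hp)

end IdealNormCount

/-- `c_K(p^e) ≤ (e+1)^{[K:ℚ]}` (real form, as consumed by `LogEulerProduct.lean`). [folklore] -/
theorem idealNormCount_prime_pow_le (p e : ℕ) (hp : p.Prime) :
    (idealNormCount K (p ^ e) : ℝ) ≤ ((e : ℝ) + 1) ^ Module.finrank ℚ K := by
  exact_mod_cast IdealNormCount.idealNormCount_prime_pow_le_nat K hp e

/-- The crude bound `c_K(p) ≤ 2^{[K:ℚ]}` for `p` prime (case `e = 1` of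
`idealNormCount_prime_pow_le`; the sharp bound is `[K:ℚ]`, not needed here). [folklore] -/
theorem idealNormCount_prime_le {p : ℕ} (hp : p.Prime) :
    (idealNormCount K p : ℝ) ≤ (2 : ℝ) ^ Module.finrank ℚ K := by
  have := idealNormCount_prime_pow_le K p 1 hp
  norm_num at this
  exact this

/-! ### The real Dedekind zeta function for real `s > 1` -/

/-- An `L`-series with natural coefficients at a real point `s > 0` is the real series
`Σ c(n) n^{-s}`. [folklore] -/
lemma LSeries_natCast_ofReal (c : ℕ → ℕ) {s : ℝ} (hs : 0 < s) :
    LSeries (fun n ↦ (c n : ℂ)) s = ((∑' n, LogEulerProduct.term c s n : ℝ) : ℂ) := by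
  rw [LSeries, Complex.ofReal_tsum]
  refine tsum_congr fun n => ?_
  rcases Nat.eq_zero_or_pos n with rfl | hn
  · simp [LSeries.term, LogEulerProduct.term_zero hs]
  · rw [LSeries.term_of_ne_zero hn.ne', LogEulerProduct.term]
    push_cast
    rw [Complex.ofReal_cpow (Nat.cast_nonneg n) (-s)]
    push_cast
    rw [Complex.cpow_neg, div_eq_mul_inv]

/-- Term-wise version of `LSeries_natCast_ofReal`. [folklore] -/
lemma LSeries_term_natCast_ofReal (c : ℕ → ℕ) {s : ℝ} (hs : 0 < s) (n : ℕ) :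
    LSeries.term (fun n ↦ (c n : ℂ)) s n = ((LogEulerProduct.term c s n : ℝ) : ℂ) := by
  rcases Nat.eq_zero_or_pos n with rfl | hn
  · simp [LSeries.term, LogEulerProduct.term_zero hs]
  · rw [LSeries.term_of_ne_zero hn.ne', LogEulerProduct.term]
    push_cast
    rw [Complex.ofReal_cpow (Nat.cast_nonneg n) (-s)]
    push_cast
    rw [Complex.cpow_neg, div_eq_mul_inv]

/-- Real limits from complex ones along real-valued functions. [folklore] -/
lemma tendsto_of_tendsto_ofReal {f : ℝ → ℝ} {g : ℝ → ℂ} {l : Filter ℝ} {r : ℝ}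
    (hfg : ∀ᶠ s in l, g s = (f s : ℂ)) (hg : Tendsto g l (𝓝 (r : ℂ))) : Tendsto f l (𝓝 r) := by
  have h1 : Tendsto (fun s => (g s).re) l (𝓝 ((r : ℂ).re)) :=
    (Complex.continuous_re.tendsto _).comp hg
  rw [Complex.ofReal_re] at h1
  refine h1.congr' ?_
  filter_upwards [hfg] with s hs
  rw [hs, Complex.ofReal_re]

/-- If `(s-1) L(c, s) → r` (`s → 1⁺`, complex `L`-series at real points) then the same holds
for the real series `Σ c(n) n^{-s}`. [folklore] -/
lemma tendsto_sub_one_mul_tsum_of_LSeries (c : ℕ → ℕ) {r : ℝ}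
    (h : Tendsto (fun s : ℝ ↦ (s - 1) * LSeries (fun n ↦ (c n : ℂ)) s) (𝓝[>] 1) (𝓝 (r : ℂ))) :
    Tendsto (fun s : ℝ => (s - 1) * ∑' n, LogEulerProduct.term c s n) (𝓝[>] 1) (𝓝 r) := by
  refine tendsto_of_tendsto_ofReal ?_ h
  filter_upwards [self_mem_nhdsWithin] with s (hs : 1 < s)
  rw [LSeries_natCast_ofReal c (by linarith)]
  push_cast
  ring

/-- Absolute convergence of `Σ c_K(n) n^{-s}` for real `s > 1`. [folklore] -/
theorem summable_term_idealNormCount {s : ℝ} (hs : 1 < s) :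
    Summable (LogEulerProduct.term (idealNormCount K) s) := by
  have h : Summable fun n => LSeries.term (fun n ↦ (idealNormCount K n : ℂ)) s n :=
    LSeriesSummable_dedekindZeta (K := K) (s := s) (by simp only [Complex.ofReal_re]; exact hs)
  have h' : Summable fun n => ((LogEulerProduct.term (idealNormCount K) s n : ℝ) : ℂ) :=
    h.congr fun n => LSeries_term_natCast_ofReal _ (by linarith) n
  exact Complex.summable_ofReal.mp h'

/-- Real form of the class number formula residue: `(s-1) Σ c_K(n) n^{-s} → ρ_K > 0`
(`s → 1⁺`), from Mathlib's `NumberField.tendsto_sub_one_mul_dedekindZeta_nhdsGT`. [folklore] -/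
theorem tendsto_sub_one_mul_tsum_idealNormCount :
    Tendsto (fun s : ℝ => (s - 1) * ∑' n, LogEulerProduct.term (idealNormCount K) s n)
      (𝓝[>] 1) (𝓝 (dedekindZeta_residue K)) :=
  tendsto_sub_one_mul_tsum_of_LSeries _ (tendsto_sub_one_mul_dedekindZeta_nhdsGT K)

/-! ### `Σ_p c_K(p) p^{-s} + log (s-1)` converges as `s → 1⁺` -/

/-- **`log ζ_K` at `1⁺`, degree-one part.** There is `L_K ∈ ℝ` with
`Σ_p c_K(p) p^{-s} + log (s-1) → L_K` as `s → 1⁺`, where `c_K(p)` is the number of prime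
ideals of `𝓞 K` of norm `p`. [folklore] -/
theorem exists_tendsto_tsum_primes_idealNormCount_add_log :
    ∃ L : ℝ, Tendsto (fun s : ℝ => ∑' p : Nat.Primes,
      (idealNormCount K p : ℝ) * (p : ℝ) ^ (-s) + Real.log (s - 1)) (𝓝[>] 1) (𝓝 L) :=
  LogEulerProduct.exists_tendsto_tsum_primes_add_log (idealNormCount_one K)
    (fun _ _ h => idealNormCount_mul_of_coprime K h) (idealNormCount_prime_pow_le K)
    (fun _ hs => summable_term_idealNormCount K hs) (dedekindZeta_residue_pos K)
    (tendsto_sub_one_mul_tsum_idealNormCount K)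

/-! ### The case `K = ℚ`: `Σ_p p^{-s} + log (s-1)` converges -/

/-- `c_ℚ(n) = 1` for every `n`: the tree's `card_ideal_rat_absNorm_eq` (`DedekindZeta.lean`).
[folklore] -/
lemma idealNormCount_rat (n : ℕ) : idealNormCount ℚ n = 1 :=
  card_ideal_rat_absNorm_eq n

/-- There is `L ∈ ℝ` with `Σ_p p^{-s} + log (s-1) → L` as `s → 1⁺` (the case `K = ℚ` of
`exists_tendsto_tsum_primes_idealNormCount_add_log`, as `c_ℚ ≡ 1`). [folklore] -/
theorem exists_tendsto_tsum_primes_rpow_add_log :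
    ∃ L : ℝ, Tendsto (fun s : ℝ => ∑' p : Nat.Primes, (p : ℝ) ^ (-s) + Real.log (s - 1))
      (𝓝[>] 1) (𝓝 L) := by
  obtain ⟨L, hL⟩ := exists_tendsto_tsum_primes_idealNormCount_add_log ℚ
  refine ⟨L, hL.congr' ?_⟩
  filter_upwards with s
  congr 1
  refine tsum_congr fun p => ?_
  rw [idealNormCount_rat, Nat.cast_one, one_mul]

/-! ### `Σ_p (c_K(p) - 1) p^{-s}` converges as `s → 1⁺` -/

/-- **Dirichlet-density form of "the average number of degree-one primes above `p` is 1".**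
There is `L ∈ ℝ` with `Σ_p (c_K(p) - 1) p^{-s} → L` as `s → 1⁺`. [folklore] -/
theorem exists_tendsto_tsum_primes_idealNormCount_sub_one :
    ∃ L : ℝ, Tendsto (fun s : ℝ => ∑' p : Nat.Primes,
      ((idealNormCount K p : ℝ) - 1) * (p : ℝ) ^ (-s)) (𝓝[>] 1) (𝓝 L) := by
  obtain ⟨L₁, h₁⟩ := exists_tendsto_tsum_primes_idealNormCount_add_log K
  obtain ⟨L₂, h₂⟩ := exists_tendsto_tsum_primes_rpow_add_log
  refine ⟨L₁ - L₂, (h₁.sub h₂).congr' ?_⟩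
  filter_upwards [self_mem_nhdsWithin] with s (hs : 1 < s)
  have hS₁ : Summable fun p : Nat.Primes => (idealNormCount K p : ℝ) * (p : ℝ) ^ (-s) :=
    LogEulerProduct.summable_primes_of_summable (F := LogEulerProduct.term (idealNormCount K) s)
      (summable_term_idealNormCount K hs)
  have hS₂ : Summable fun p : Nat.Primes => (p : ℝ) ^ (-s) :=
    Nat.Primes.summable_rpow.mpr (by linarith)
  rw [show ∑' p : Nat.Primes, ((idealNormCount K p : ℝ) - 1) * (p : ℝ) ^ (-s) =
      ∑' p : Nat.Primes, ((idealNormCount K p : ℝ) * (p : ℝ) ^ (-s) - (p : ℝ) ^ (-s)) from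
      tsum_congr fun p => by ring, hS₁.tsum_sub hS₂]
  ring

end Literature.NumberTheory.LFunctions
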